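import Mathlib
import Summits.ValiantsHypothesis.ValiantsHypothesis.Theorems.ProofCarryingSymmetryRestorationQPESatHom

/-!
# Route ProofCarryingSymmetry — crux `RestorationQP`, line `registered`: e-saturated normal forms —
few AC-classes are reachable from the e-saturated unfolding of a circuit

Support file for the crux item `stmt-ValiantsHypothesis-10343` (lead c5, rung S3^(1)-inv, stub
`esat_card_reach`), continuing `…ESatHom`.  For a GENERIC ground distributivity instance `d` and a
Hrubeš–Tzameret circuit `C`:  `(reach (esatClass d C)).card ≤ 3 (|C| + 1) + 12`
(`card_reach_esatClass_le`), the gate budget of the AC-canonical circuit of the e-saturation.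
Peeling re-nests long factor lists into left combs, so `esat d C•` may have exponentially many
distinct SUBFORMULAS; the bound lives at the level of CLASSES (`kids` flattens through `×`, `+`):
a class reachable from `⟦x⟧` is `⟦x⟧`, the class of the root constant, or reachable from a ROOT
FACTOR (`reach_mk_subset_margs`; dually `reach_mk_subset_asplit`), so the reach of a smart sum /
peeled smart product of normal forms is itself, one constant class, the reach of the arguments and
— when peeling fires — the reach of the expansion `sig`: nine classes attached to `d` plus the reach
of the PATTERN classes, which the firing condition `pat ≤ mset (smul x y)` puts below the arguments
(`reach_mk_sadd_subset`, `reach_mk_emul_subset`, `exists_reach_mk_sig_subset`).  By induction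
(`reach_mk_esat_subset`) every class reachable from `⟦esat d K⟧` is, for a subformula `J` of `K`,
`⟦esat d J⟧`, `⟦const (asplit (esat d J)).2⟧`, `⟦const (mcst (esat d J))⟧`, or attached to `d`;
conclude by `card_subs_unfold_le`.  Everything here is elementary and proved; no named facts.
-/

-- single-problem summit: `Summit.ValiantsHypothesis.ValiantsHypothesis.…` is the namespace by design (D-0017)
set_option linter.dupNamespace false

noncomputable section

open scoped Classical

namespace Summit.ValiantsHypothesis.ValiantsHypothesis.Theorems

namespace ACStability

open Literature.Computability.AlgebraicComplexity ACClass

universe u v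

variable {𝔽 : Type u} {X : Type v}

/-- Classes reachable from a reachable class are reachable. [folklore] -/
theorem reach_subset_of_mem_reach {t q : ACClass 𝔽 X} (h : q ∈ reach t) : reach q ⊆ reach t :=
  fun _ hk => mem_reach.2 ((mem_reach.1 h).trans (mem_reach.1 hk))

/-- A class reachable from `⟦F⟧` is `⟦F⟧` or reachable from the class of a flattened child. [folklore] -/
theorem mem_reach_mk_cases {F : PIFormula 𝔽 X} {q : ACClass 𝔽 X} (h : q ∈ reach (mk F)) :
    q = mk F ∨ ∃ K ∈ ACStability.kids F, q ∈ reach (mk K) := by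
  rcases Relation.ReflTransGen.cases_head (mem_reach.1 h) with h' | ⟨k, hk, hkq⟩
  · exact Or.inl h'.symm
  · simp only [kids_mk, Multiset.mem_coe, List.mem_map] at hk
    obtain ⟨K, hK, rfl⟩ := hk
    exact Or.inr ⟨K, hK, mem_reach.2 hkq⟩

/-- Bounding the reach of `⟦F⟧` by the reach of the flattened children of `F`. [folklore] -/
theorem reach_mk_subset_insert {F : PIFormula 𝔽 X} {S : Finset (ACClass 𝔽 X)}
    (h : ∀ K ∈ ACStability.kids F, reach (mk K) ⊆ S) : reach (mk F) ⊆ insert (mk F) S := by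
  intro q hq
  rcases mem_reach_mk_cases hq with rfl | ⟨K, hK, hqK⟩
  · exact Finset.mem_insert_self _ _
  · exact Finset.mem_insert_of_mem (h K hK hqK)

/-- Only the leaf itself is reachable from a constant leaf. [folklore] -/
theorem reach_mk_const_subset (c : 𝔽) {S : Finset (ACClass 𝔽 X)} (h : mk (.const c) ∈ S) :
    reach (mk (.const c : PIFormula 𝔽 X)) ⊆ S := fun q hq => by
  rcases mem_reach_mk_cases hq with rfl | ⟨K, hK, -⟩
  · exact h
  · simp at hK

/-- The flattened summands of a merge come from the merged parts. [folklore] -/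
theorem mem_addArgs_amerge {ox oy : Option (PIFormula 𝔽 X)} {m f : PIFormula 𝔽 X}
    (hm : amerge ox oy = some m) (hf : f ∈ addArgs m) :
    (∃ px, ox = some px ∧ f ∈ addArgs px) ∨ (∃ py, oy = some py ∧ f ∈ addArgs py) := by
  cases ox with
  | none => exact Or.inr ⟨m, hm, hf⟩
  | some px =>
    cases oy with
    | none =>
      obtain rfl : px = m := by simpa using hm
      exact Or.inl ⟨px, rfl, hf⟩
    | some py =>
      obtain rfl : PIFormula.add px py = m := by simpa using hm
      rw [addArgs_add, List.mem_append] at hf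
      exact hf.imp (fun h => ⟨px, rfl, h⟩) (fun h => ⟨py, rfl, h⟩)

section Semiring

variable [CommSemiring 𝔽]

/-- The reach of a root factor of `x` (`x` itself or a flattened child) lies below `⟦x⟧`. [folklore] -/
theorem reach_mk_subset_of_mem_margs {x f : PIFormula 𝔽 X} (h : f ∈ margs x) :
    reach (mk f) ⊆ reach (mk x) := by
  have hkid : f ∈ ACStability.kids x → reach (mk f) ⊆ reach (mk x) := fun h =>
    reach_subset_of_mem_reach (mem_reach_of_mem_kids (self_mem_reach _)
      (by rw [kids_mk]; exact Multiset.mem_coe.2 (List.mem_map.2 ⟨f, h, rfl⟩)))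
  cases x with
  | const c => simp at h
  | mul a b =>
    refine hkid ?_
    rw [kids_mul, List.mem_append]
    cases hb : constOf b with
    | some c =>
      obtain rfl := constOf_eq_some.1 hb
      simp only [margs_def, msplit_mul_const, omulArgs_some] at h
      exact Or.inl h
    | none =>
      rw [margs_def, msplit_mul_of_ne hb, omulArgs_some, mulArgs_mul, List.mem_append] at h
      exact h
  | _ =>
    obtain rfl : f = _ := by simpa [margs_def, mulArgs] using h
    exact subset_rfl

/-- **Reach through the root factors**: a class reachable from `⟦x⟧` is `⟦x⟧`, the class of the
root constant `mcst x`, or reachable from the class of a root factor of `x`. [folklore] -/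
theorem reach_mk_subset_margs (x : PIFormula 𝔽 X) {S : Finset (ACClass 𝔽 X)}
    (h : ∀ f ∈ margs x, reach (mk f) ⊆ S) :
    reach (mk x) ⊆ insert (mk x) (insert (mk (.const (mcst x))) S) := by
  have hS : S ⊆ insert (mk x) (insert (mk (.const (mcst x))) S) :=
    (Finset.subset_insert _ _).trans (Finset.subset_insert _ _)
  cases x with
  | const c => exact reach_mk_const_subset c (Finset.mem_insert_self _ _)
  | mul a b =>
    refine reach_mk_subset_insert fun K hK => ?_
    rw [kids_mul, List.mem_append] at hK
    cases hb : constOf b with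
    | some c =>
      obtain rfl := constOf_eq_some.1 hb
      have hm : margs (PIFormula.mul a (.const c)) = mulArgs a := by simp [margs_def]
      rcases hK with hK | hK
      · exact (h K (hm ▸ hK)).trans (Finset.subset_insert _ _)
      · obtain rfl : K = .const c := by simpa [mulArgs] using hK
        exact reach_mk_const_subset c (Finset.mem_insert_self _ _)
    | none =>
      have hm : margs (PIFormula.mul a b) = mulArgs a ++ mulArgs b := by
        rw [margs_def, msplit_mul_of_ne hb]; rfl
      exact (h K (by rw [hm, List.mem_append]; exact hK)).trans (Finset.subset_insert _ _)
  | _ => exact (h _ (by simp [margs_def, mulArgs])).trans hS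

/-- The flattened summands of the non-constant summand of `x` are reachable from `⟦x⟧`. [folklore] -/
theorem mk_mem_reach_of_asplit {x px f : PIFormula 𝔽 X} (hp : (asplit x).1 = some px)
    (hf : f ∈ addArgs px) : mk f ∈ reach (mk x) := by
  cases x with
  | const c => simp at hp
  | add a b =>
    refine mem_reach_of_mem_kids (self_mem_reach _) ?_
    rw [kids_mk, kids_add]
    refine Multiset.mem_coe.2 (List.mem_map.2 ⟨f, ?_, rfl⟩)
    cases hb : constOf b with
    | some c =>
      obtain rfl := constOf_eq_some.1 hb
      obtain rfl : a = px := by simpa using hp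
      exact List.mem_append_left _ hf
    | none =>
      rw [asplit_add_of_ne hb] at hp
      obtain rfl : PIFormula.add a b = px := by simpa using hp
      simpa using hf
  | _ =>
    simp at hp; subst hp
    obtain rfl : f = _ := by simpa [addArgs] using hf
    exact self_mem_reach _

/-- **Reach through the additive shape**: a class reachable from `⟦a⟧` is `⟦a⟧`, the class of the
constant summand, or reachable from a flattened summand of the non-constant summand. [folklore] -/
theorem reach_mk_subset_asplit (a : PIFormula 𝔽 X) {S : Finset (ACClass 𝔽 X)}
    (h : ∀ pa, (asplit a).1 = some pa → ∀ f ∈ addArgs pa, reach (mk f) ⊆ S) :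
    reach (mk a) ⊆ insert (mk a) (insert (mk (.const (asplit a).2)) S) := by
  have hS : S ⊆ insert (mk a) (insert (mk (.const (asplit a).2)) S) :=
    (Finset.subset_insert _ _).trans (Finset.subset_insert _ _)
  cases a with
  | const c => exact reach_mk_const_subset c (Finset.mem_insert_self _ _)
  | add p q =>
    refine reach_mk_subset_insert fun K hK => ?_
    rw [kids_add, List.mem_append] at hK
    cases hq : constOf q with
    | some c =>
      obtain rfl := constOf_eq_some.1 hq
      simp only [asplit_add_const]
      rcases hK with hK | hK
      · exact (h p rfl K hK).trans (Finset.subset_insert _ _)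
      · obtain rfl : K = .const c := by simpa [addArgs] using hK
        exact reach_mk_const_subset c (Finset.mem_insert_self _ _)
    | none =>
      exact (h (.add p q) (by rw [asplit_add_of_ne hq]) K (by simpa using hK)).trans
        (Finset.subset_insert _ _)
  | _ => exact (h _ rfl _ (by simp [addArgs])).trans hS

/-- **Reach of a smart sum of normal forms**: itself, its constant summand, or below an argument.
[folklore] -/
theorem reach_mk_sadd_subset {x y : PIFormula 𝔽 X} (hx : NF x) (hy : NF y) :
    reach (mk (sadd x y)) ⊆ insert (mk (sadd x y))
      (insert (mk (.const (asplit (sadd x y)).2)) (reach (mk x) ∪ reach (mk y))) := by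
  refine reach_mk_subset_asplit (sadd x y) fun m hm f hf => ?_
  simp only [asplit_sadd hx hy] at hm
  rcases mem_addArgs_amerge hm hf with ⟨px, hpx, hf⟩ | ⟨py, hpy, hf⟩
  · exact (reach_subset_of_mem_reach (mk_mem_reach_of_asplit hpx hf)).trans Finset.subset_union_left
  · exact (reach_subset_of_mem_reach (mk_mem_reach_of_asplit hpy hf)).trans Finset.subset_union_right

/-- **An argument of a smart sum of normal forms is nearly reachable from it**: a class reachable
from `⟦a⟧` is `⟦a⟧`, the class of its constant summand, or reachable from `⟦sadd a b⟧`. [folklore] -/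
theorem reach_mk_subset_sadd_left {a b : PIFormula 𝔽 X} (ha : NF a) (hb : NF b) :
    reach (mk a) ⊆ insert (mk a) (insert (mk (.const (asplit a).2)) (reach (mk (sadd a b)))) := by
  refine reach_mk_subset_asplit a fun pa hpa f hf => reach_subset_of_mem_reach ?_
  have hm : (asplit (sadd a b)).1 = amerge (some pa) (asplit b).1 := by
    simp only [asplit_sadd ha hb, hpa]
  cases hpb : (asplit b).1 with
  | none =>
    rw [hpb, amerge_some_none] at hm
    exact mk_mem_reach_of_asplit hm hf
  | some pb =>
    rw [hpb, amerge_some_some] at hm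
    exact mk_mem_reach_of_asplit hm (by rw [addArgs_add]; exact List.mem_append_left _ hf)

end Semiring

section Field

variable [Field 𝔽] {d : DistData 𝔽 X}

/-- The flattened children of the expansion of a generic instance: `p · q` and `p · r`. [folklore] -/
theorem DistData.Generic.kids_sig (hg : d.Generic) :
    ACStability.kids d.sig = [smul d.p d.q, smul d.p d.r] := by
  have H : ∀ {b : PIFormula 𝔽 X}, NF b → (msplit d.p).2 * (msplit b).2 ≠ 0 → 1 ≤ nvars b →
      addArgs (smul d.p b) = [smul d.p b] := fun {b} hb h hb1 => by
    obtain ⟨m, hm⟩ := DistData.msplit_fst_isSome_of_nvars d.nf_p hg.1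
    obtain ⟨m', hm'⟩ := DistData.msplit_fst_isSome_of_nvars hb hb1
    rw [smul_of_ne_zero h, hm, hm', mmerge_some_some]
    by_cases hc : (msplit d.p).2 * (msplit b).2 = 1
    · rw [hc, mmk_some_one]; rfl
    · rw [mmk_some_of_ne _ hc]; rfl
  rw [hg.sig_eq, kids_add, H d.nf_q hg.mcst_mul_ne_zero.1 hg.2.1,
    H d.nf_r hg.mcst_mul_ne_zero.2 hg.2.2]
  rfl

/-- Reach of the smart product `p · b` for `b = q, r`: four classes attached to the instance, or
below a pattern class (the root factors of `p`; `s`, above the summands of `q`, `r`). [folklore] -/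
theorem reach_mk_smul_p_subset (d : DistData 𝔽 X) {b : PIFormula 𝔽 X} (hb : NF b)
    (hb0 : mcst d.p * mcst b ≠ 0)
    (hbr : reach (mk b) ⊆ insert (mk b) (insert (mk (.const (asplit b).2)) (reach (mk d.s)))) :
    reach (mk (smul d.p b)) ⊆
      {mk (smul d.p b), mk (.const (mcst (smul d.p b))), mk b, mk (.const (asplit b).2)} ∪
        d.pat.toFinset.biUnion reach := by
  have hs : reach (mk d.s) ⊆ d.pat.toFinset.biUnion reach :=
    Finset.subset_biUnion_of_mem reach (Multiset.mem_toFinset.2 d.mk_s_mem_pat)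
  have key : reach (mk (smul d.p b)) ⊆ insert (mk (smul d.p b))
      (insert (mk (.const (mcst (smul d.p b)))) (d.pat.toFinset.biUnion reach ∪ reach (mk b))) := by
    refine reach_mk_subset_margs _ fun f hf => ?_
    rw [margs_smul d.nf_p hb hb0, List.mem_append] at hf
    rcases hf with hf | hf
    · refine (Finset.subset_biUnion_of_mem reach ?_).trans Finset.subset_union_left
      simp only [DistData.pat, DistData.patF, Multiset.mem_toFinset, Multiset.mem_coe, List.mem_map,
        List.mem_append]
      exact ⟨f, Or.inl hf, rfl⟩
    · exact (reach_mk_subset_of_mem_margs hf).trans Finset.subset_union_right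
  refine key.trans (Finset.insert_subset_iff.2 ⟨?_, Finset.insert_subset_iff.2 ⟨?_,
    Finset.union_subset Finset.subset_union_right (hbr.trans (Finset.insert_subset_iff.2 ⟨?_,
      Finset.insert_subset_iff.2 ⟨?_, hs.trans Finset.subset_union_right⟩⟩))⟩⟩)
  · exact Finset.mem_union_left _ (Finset.mem_insert_self _ _)
  · exact Finset.mem_union_left _ (Finset.mem_insert_of_mem (Finset.mem_insert_self _ _))
  · exact Finset.mem_union_left _
      (Finset.mem_insert_of_mem (Finset.mem_insert_of_mem (Finset.mem_insert_self _ _)))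
  · exact Finset.mem_union_left _ (Finset.mem_insert_of_mem (Finset.mem_insert_of_mem
      (Finset.mem_insert_of_mem (Finset.mem_singleton_self _))))

/-- **At most twelve classes are attached to a generic instance**: the reach of the expansion
`sig = p·q + p·r` is a fixed set of `≤ 12` (indeed `9`) classes plus the reach of the pattern. [folklore] -/
theorem exists_reach_mk_sig_subset (hg : d.Generic) : ∃ G : Finset (ACClass 𝔽 X),
    G.card ≤ 12 ∧ reach (mk d.sig) ⊆ G ∪ d.pat.toFinset.biUnion reach := by
  have hq := reach_mk_subset_sadd_left d.nf_q d.nf_r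
  have hr := reach_mk_subset_sadd_left d.nf_r d.nf_q
  rw [show mk (sadd d.r d.q) = mk d.s from mk_eq_mk.2 (acEq_sadd_comm d.r d.q)] at hr
  refine ⟨insert (mk d.sig)
    ({mk (smul d.p d.q), mk (.const (mcst (smul d.p d.q))), mk d.q, mk (.const (asplit d.q).2)} ∪
      {mk (smul d.p d.r), mk (.const (mcst (smul d.p d.r))), mk d.r, mk (.const (asplit d.r).2)}),
    (Finset.card_insert_le _ _).trans (Nat.succ_le_succ (((Finset.card_union_le _ _).trans
      (Nat.add_le_add Finset.card_le_four Finset.card_le_four)).trans (by norm_num))), ?_⟩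
  rw [Finset.insert_union]
  refine reach_mk_subset_insert fun K hK => ?_
  rw [hg.kids_sig] at hK
  simp only [List.mem_cons, List.not_mem_nil, or_false] at hK
  rcases hK with rfl | rfl
  · exact (reach_mk_smul_p_subset d d.nf_q hg.mcst_mul_ne_zero.1 hq).trans
      (Finset.union_subset_union Finset.subset_union_left subset_rfl)
  · exact (reach_mk_smul_p_subset d d.nf_r hg.mcst_mul_ne_zero.2 hr).trans
      (Finset.union_subset_union Finset.subset_union_right subset_rfl)

/-- **At firing, the reach of the pattern lies below the arguments**: if a copy of the pattern
peels from `smul x y`, every pattern class is the class of a root factor of `x` or `y`. [folklore] -/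
theorem pat_biUnion_reach_subset {x y : PIFormula 𝔽 X} (hx : NF x) (hy : NF y)
    (h0 : mcst x * mcst y ≠ 0) (hk : kmax (mset (smul x y)) d.pat ≠ 0) :
    d.pat.toFinset.biUnion reach ⊆ reach (mk x) ∪ reach (mk y) := by
  have hle : d.pat ≤ mset (smul x y) := not_not.1 fun hn => hk ((kmax_eq_zero_iff d.pat_ne_zero).2 hn)
  intro c hc
  obtain ⟨a, ha, hca⟩ := Finset.mem_biUnion.1 hc
  have ha' : a ∈ mset (smul x y) := Multiset.mem_of_le hle (Multiset.mem_toFinset.1 ha)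
  rw [mset_def, margs_smul hx hy h0, Multiset.mem_coe, List.mem_map] at ha'
  obtain ⟨f, hf, rfl⟩ := ha'
  rcases List.mem_append.1 hf with hf | hf
  · exact Finset.mem_union_left _ (reach_mk_subset_of_mem_margs hf hca)
  · exact Finset.mem_union_right _ (reach_mk_subset_of_mem_margs hf hca)

/-- **Reach of the peeled smart product of normal forms**: itself, the class of its root constant,
the classes `G` attached to the instance, or reachable from an argument. [folklore] -/
theorem reach_mk_emul_subset (hg : d.Generic) {G : Finset (ACClass 𝔽 X)}
    (hG : reach (mk d.sig) ⊆ G ∪ d.pat.toFinset.biUnion reach) {x y : PIFormula 𝔽 X}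
    (hx : NF x) (hy : NF y) :
    reach (mk (emul d x y)) ⊆ insert (mk (emul d x y)) (insert (mk (.const (mcst (emul d x y))))
      (G ∪ (reach (mk x) ∪ reach (mk y)))) := by
  refine reach_mk_subset_margs _ fun f hf => ?_
  by_cases h0 : mcst x * mcst y = 0
  · rw [emul_of_mcst_eq_zero h0, margs_const] at hf
    simp at hf
  have hxy : ∀ g ∈ margs x ++ margs y, reach (mk g) ⊆ G ∪ (reach (mk x) ∪ reach (mk y)) := by
    intro g hg'
    refine subset_trans ?_ Finset.subset_union_right
    rcases List.mem_append.1 hg' with hg' | hg'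
    · exact (reach_mk_subset_of_mem_margs hg').trans Finset.subset_union_left
    · exact (reach_mk_subset_of_mem_margs hg').trans Finset.subset_union_right
  by_cases hk : kmax (mset (smul x y)) d.pat = 0
  · rw [emul, epeel_of_saturated hk, margs_smul hx hy h0] at hf
    exact hxy f hf
  · rw [emul, margs_epeel hg (nf_smul hx hy) hk] at hf
    rcases List.mem_append.1 hf with hf | hf
    · have hf' := mem_of_mem_removeBy hf
      rw [margs_smul hx hy h0] at hf'
      exact hxy f hf'
    · rw [List.eq_of_mem_replicate hf]
      exact hG.trans (Finset.union_subset_union subset_rfl (pat_biUnion_reach_subset hx hy h0 hk))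

/-- **The key lemma.**  A class reachable from `⟦esat d K⟧` lies, for some subformula `J` of `K`, in
`T J` — any set containing `⟦esat d J⟧`, the class of the constant summand of `esat d J` and the
class of its root constant — or in the set `G` attached to the instance. [folklore] -/
theorem reach_mk_esat_subset (hg : d.Generic) {G : Finset (ACClass 𝔽 X)}
    (hG : reach (mk d.sig) ⊆ G ∪ d.pat.toFinset.biUnion reach)
    {T : PIFormula 𝔽 X → Finset (ACClass 𝔽 X)}
    (hT : ∀ J, mk (esat d J) ∈ T J ∧ mk (.const (asplit (esat d J)).2) ∈ T J ∧
      mk (.const (mcst (esat d J))) ∈ T J)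
    (K : PIFormula 𝔽 X) : reach (mk (esat d K)) ⊆ (subs K).toFinset.biUnion T ∪ G := by
  have mono : ∀ {K K' : PIFormula 𝔽 X}, K' ∈ subs K →
      (subs K').toFinset.biUnion T ∪ G ⊆ (subs K).toFinset.biUnion T ∪ G := fun h =>
    Finset.union_subset_union (Finset.biUnion_subset_biUnion_of_subset_left T fun J hJ =>
      List.mem_toFinset.2 (subs_subset_of_mem h (List.mem_toFinset.1 hJ))) subset_rfl
  have hself : ∀ (K : PIFormula 𝔽 X) {c : ACClass 𝔽 X}, c ∈ T K →
      c ∈ (subs K).toFinset.biUnion T ∪ G := fun K _ hc =>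
    Finset.mem_union_left _ (Finset.mem_biUnion.2 ⟨K, List.mem_toFinset.2 (mem_subs_self K), hc⟩)
  induction K with
  | add a b iha ihb =>
    obtain ⟨h1, h2, -⟩ := hT (.add a b)
    rw [esat_add] at h1 h2 ⊢
    refine (reach_mk_sadd_subset (nf_esat hg a) (nf_esat hg b)).trans (Finset.insert_subset_iff.2
      ⟨hself _ h1, Finset.insert_subset_iff.2 ⟨hself _ h2, Finset.union_subset ?_ ?_⟩⟩)
    · exact iha.trans (mono (by simp [subs, mem_subs_self]))
    · exact ihb.trans (mono (by simp [subs, mem_subs_self]))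
  | mul a b iha ihb =>
    obtain ⟨h1, -, h3⟩ := hT (.mul a b)
    rw [esat_mul] at h1 h3 ⊢
    refine (reach_mk_emul_subset hg hG (nf_esat hg a) (nf_esat hg b)).trans
      (Finset.insert_subset_iff.2 ⟨hself _ h1, Finset.insert_subset_iff.2 ⟨hself _ h3,
        Finset.union_subset Finset.subset_union_right (Finset.union_subset ?_ ?_)⟩⟩)
    · exact iha.trans (mono (by simp [subs, mem_subs_self]))
    · exact ihb.trans (mono (by simp [subs, mem_subs_self]))
  | _ =>
    intro q hq
    rcases mem_reach_mk_cases hq with rfl | ⟨K, hK, -⟩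
    · exact hself _ (hT _).1
    · simp at hK

/-- **Gate budget of the e-saturation** (generic instance): at most `3 (|C| + 1) + 12` classes are
reachable from `esatClass d C` — three per distinct subformula of `C•`, twelve for `d`. [folklore] -/
theorem card_reach_esatClass_le (hg : d.Generic) (C : PICircuit 𝔽 X) :
    (reach (esatClass d C)).card ≤ 3 * (C.size + 1) + 12 := by
  obtain ⟨G, hGc, hG⟩ := exists_reach_mk_sig_subset hg
  set T : PIFormula 𝔽 X → Finset (ACClass 𝔽 X) := fun J =>
    {mk (esat d J), mk (.const (asplit (esat d J)).2), mk (.const (mcst (esat d J)))}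
  have key := reach_mk_esat_subset hg hG (T := T) (fun J => ⟨Finset.mem_insert_self _ _,
    Finset.mem_insert_of_mem (Finset.mem_insert_self _ _),
    Finset.mem_insert_of_mem (Finset.mem_insert_of_mem (Finset.mem_singleton_self _))⟩) C.unfold
  have h3 := Finset.card_biUnion_le_card_mul (subs C.unfold).toFinset T 3
    fun _ _ => Finset.card_le_three
  have h4 := Nat.mul_le_mul_right 3 (card_subs_unfold_le C)
  change (reach (mk (esat d C.unfold))).card ≤ _
  refine (Finset.card_le_card key).trans ((Finset.card_union_le _ _).trans ?_)
  omega

end Field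

end ACStability

open Literature.Computability.AlgebraicComplexity in
/-- **Registered stub `esat_card_reach`** (line `registered` of crux `RestorationQP`, item
stmt-ValiantsHypothesis-10343, rung S3^(1)-inv): for a generic ground distributivity instance `d`, at
most `3 (|C| + 1) + 12` AC-classes are reachable along `kids` from `⟦esat d C•⟧`. [folklore] -/
theorem esat_card_reach : ∀ {𝔽 : Type} [Field 𝔽] {X : Type} (d : ACStability.DistData 𝔽 X), d.Generic → ∀ C : PICircuit 𝔽 X, (ACStability.ACClass.reach (ACStability.esatClass d C)).card ≤ 3 * (C.size + 1) + 12 :=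
  fun _ hg C => ACStability.card_reach_esatClass_le hg C

end Summit.ValiantsHypothesis.ValiantsHypothesis.Theorems

end
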